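import Summits.ABC.StewartYu.PadicLogFormsPrincipalReduction
import Summits.ABC.StewartYu.WeightedLatticeBasisSharp
import HarnessLib

/-!
# Reduction of `p`-adic linear forms in logarithms of primes to Kummer-free principal generators,
# sharp form (WP-M♭): heights product `≤ m^m √(m!) · p · ∏ log qᵢ`

Cell topic `Summits/ABC/StewartYu` (cell abc-stewartyu, HOME `run/shared/lean/pub/abc-stewartyu/`,
seat p1); namespace `Summit.ABC.StewartYu.PrincipalLattice` (theorems only, no definition, no named
fact). Sequel to `PadicLogFormsPrincipalReduction.lean` (WP-M, `exists_principal_generators`: the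
same statement with `∏ h(αⱼ) ≤ m^{2m} · p · ∏ log qᵢ`).

* `factorial_succ_le`, `factorial_mul_le`, `pow_mul_sqrt_factorial_mul_le` — the numerical
  inequalities `(k+1)! ≤ 3 (log 2)^{k+1} (k+1)^k`, `m! · m ≤ 3 (log 2)^m m^m` and
  `m^m √(m!) · m ≤ 3 (log 2)^m m^{2m}` (Bernoulli `(1 + 1/(k+1))^k ≥ 3/2`, `log 2 ≥ 2/3`), which
  keep the exponent clause `|e'ⱼ| ≤ m^{2m} p (∏ log qᵢ) max|eᵢ|` of WP-M unchanged;
* `exists_principal_generators_sharp` — **WP-M♭**: for an odd prime `p`, distinct primes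
  `q₁, …, q_m ≠ p` and `e ∈ ℤ^m ∖ {0}` with `ord_p(∏ qᵢ^{eᵢ} − 1) ≥ 1`, there are rationals
  `αⱼ ≡ 1 (mod p)`, multiplicatively independent and Kummer-free, and `e' ≠ 0` with
  `∏ qᵢ^{eᵢ} = ∏ αⱼ^{e'ⱼ}`, **`∏ h(αⱼ) ≤ m^m · √(m!) · p · ∏ log qᵢ`** (`≤ m^{3m/2} p ∏ log qᵢ`),
  `|e'ⱼ| ≤ m^{2m} · p · (∏ log qᵢ) · max|eᵢ|`, `log p ≤ 2 h(αⱼ)`. The proof is that of WP-M verbatim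
  with the basis of `Λ^±` taken from `exists_basis_prod_weighted_le_sharp` (Minkowski II for the
  weighted EUCLIDEAN norm + the Euclidean Mahler basis + Cauchy–Schwarz) instead of
  `exists_basis_prod_weighted_le` (Minkowski II + Mahler for the weighted `ℓ¹` norm).

Consequence (files `GluePrincipalToPrimeGeneral.lean`, `PadicCW77EpsShapeFiveHalves.lean`): with a
Theorem-A-shaped bound of envelope `c₁^m m^{c₂ m}` the glue exponent becomes `κ = c₂ + 3/2` instead
of `c₂ + 2`, i.e. `log c ≪_ε rad(abc)^{5/2+ε}` from Theorem A₁ (`c₂ = 1`). Everything here is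
[folklore] geometry of numbers on top of results PROVED in the tree.

## References

* [EvertseGyory2015] J.-H. Evertse, K. Győry, *Unit Equations in Diophantine Number Theory*,
  Cambridge Stud. Adv. Math. 146, CUP 2015 — Thm 4.3.1, Thm 4.3.3 (p. 70), Lemma 4.3.6 (p. 72).
-/

noncomputable section

namespace Summit.ABC.StewartYu.PrincipalLattice

open Module Finset Height

/-! ### Numerical inequalities -/

/-- `(k+1)! ≤ 3 (log 2)^{k+1} (k+1)^k` for all `k` (bases `k = 0, 1`; step by Bernoulli
`(k+2)^k ≥ (3/2)(k+1)^k` for `k ≥ 1` and `(3/2) log 2 ≥ 1`). [folklore] -/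
theorem factorial_succ_le (k : ℕ) :
    ((k + 1).factorial : ℝ) ≤ 3 * Real.log 2 ^ (k + 1) * ((k : ℝ) + 1) ^ k := by
  have hL : (0.6931471803 : ℝ) < Real.log 2 := Real.log_two_gt_d9
  have hL0 : 0 < Real.log 2 := by linarith
  rcases Nat.eq_zero_or_pos k with hk | hk
  · subst hk; norm_num; linarith
  induction k, hk using Nat.le_induction with
  | base =>
    norm_num
    nlinarith
  | succ k hk ih =>
    -- Bernoulli: `(3/2) (k+1)^k ≤ (k+2)^k`
    have hk1 : (0 : ℝ) < (k : ℝ) + 1 := by positivity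
    have hB : 1 + (k : ℝ) * (1 / ((k : ℝ) + 1)) ≤ (1 + 1 / ((k : ℝ) + 1)) ^ k :=
      one_add_mul_le_pow (by rw [one_div]; linarith [inv_pos.mpr hk1]) k
    have h32 : (3 / 2 : ℝ) ≤ 1 + (k : ℝ) * (1 / ((k : ℝ) + 1)) := by
      rw [mul_one_div, ← sub_nonneg]
      have hk' : (1 : ℝ) ≤ k := by exact_mod_cast hk
      have : (3 / 2 : ℝ) = 1 + 1 / 2 := by norm_num
      rw [this, add_sub_add_left_eq_sub, sub_nonneg, div_le_div_iff₀ (by norm_num) hk1]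
      linarith
    have hpow : (3 / 2 : ℝ) * ((k : ℝ) + 1) ^ k ≤ ((k : ℝ) + 2) ^ k := by
      have h1 : ((k : ℝ) + 2) = (1 + 1 / ((k : ℝ) + 1)) * ((k : ℝ) + 1) := by
        field_simp; ring
      rw [h1, mul_pow]
      exact mul_le_mul_of_nonneg_right (h32.trans hB) (by positivity)
    -- `(k+1)^k ≤ log 2 · (k+2)^k`
    have hstep : ((k : ℝ) + 1) ^ k ≤ Real.log 2 * ((k : ℝ) + 2) ^ k := by
      have h23 : (2 / 3 : ℝ) ≤ Real.log 2 := by linarith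
      calc ((k : ℝ) + 1) ^ k = (2 / 3) * ((3 / 2) * ((k : ℝ) + 1) ^ k) := by ring
        _ ≤ (2 / 3) * ((k : ℝ) + 2) ^ k := mul_le_mul_of_nonneg_left hpow (by norm_num)
        _ ≤ Real.log 2 * ((k : ℝ) + 2) ^ k := mul_le_mul_of_nonneg_right h23 (by positivity)
    -- the step
    have hfac : ((k + 1 + 1).factorial : ℝ) = ((k : ℝ) + 2) * ((k + 1).factorial : ℝ) := by
      rw [Nat.factorial_succ (k + 1)]; push_cast; ring
    rw [hfac]
    have hk2 : (0 : ℝ) ≤ (k : ℝ) + 2 := by positivity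
    calc ((k : ℝ) + 2) * ((k + 1).factorial : ℝ)
        ≤ ((k : ℝ) + 2) * (3 * Real.log 2 ^ (k + 1) * ((k : ℝ) + 1) ^ k) :=
          mul_le_mul_of_nonneg_left ih hk2
      _ ≤ ((k : ℝ) + 2) * (3 * Real.log 2 ^ (k + 1) * (Real.log 2 * ((k : ℝ) + 2) ^ k)) :=
          mul_le_mul_of_nonneg_left (mul_le_mul_of_nonneg_left hstep (by positivity)) hk2
      _ = 3 * Real.log 2 ^ (k + 1 + 1) * (((k + 1 : ℕ) : ℝ) + 1) ^ (k + 1) := by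
          push_cast; ring

/-- `m! · m ≤ 3 (log 2)^m m^m`. [folklore] -/
theorem factorial_mul_le (m : ℕ) :
    (m.factorial : ℝ) * m ≤ 3 * Real.log 2 ^ m * (m : ℝ) ^ m := by
  rcases Nat.eq_zero_or_pos m with hm | hm
  · subst hm; norm_num
  obtain ⟨k, rfl⟩ : ∃ k, m = k + 1 := ⟨m - 1, by omega⟩
  have h := factorial_succ_le k
  have hk1 : (0 : ℝ) ≤ (k : ℝ) + 1 := by positivity
  calc (((k + 1).factorial : ℕ) : ℝ) * ((k + 1 : ℕ) : ℝ)
      ≤ (3 * Real.log 2 ^ (k + 1) * ((k : ℝ) + 1) ^ k) * ((k : ℝ) + 1) := by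
        push_cast; exact mul_le_mul_of_nonneg_right h hk1
    _ = 3 * Real.log 2 ^ (k + 1) * ((k + 1 : ℕ) : ℝ) ^ (k + 1) := by push_cast; ring

/-- `m^m √(m!) · m ≤ 3 (log 2)^m m^{2m}` (from `√(m!) ≤ m!` and `factorial_mul_le`): the constant
of `exists_basis_prod_weighted_le_sharp` still fits the exponent clause of WP-M. [folklore] -/
theorem pow_mul_sqrt_factorial_mul_le (m : ℕ) :
    (m : ℝ) ^ m * Real.sqrt (m.factorial) * m ≤ 3 * Real.log 2 ^ m * (m : ℝ) ^ (2 * m) := by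
  have hf1 : (1 : ℝ) ≤ (m.factorial : ℝ) := by exact_mod_cast Nat.one_le_iff_ne_zero.mpr (Nat.factorial_ne_zero m)
  have hsqrt : Real.sqrt (m.factorial : ℝ) ≤ (m.factorial : ℝ) := by
    calc Real.sqrt (m.factorial : ℝ) ≤ Real.sqrt ((m.factorial : ℝ) ^ 2) :=
          Real.sqrt_le_sqrt (le_self_pow₀ hf1 two_ne_zero)
      _ = (m.factorial : ℝ) := Real.sqrt_sq (by positivity)
  have hmm : (0 : ℝ) ≤ (m : ℝ) ^ m := by positivity
  calc (m : ℝ) ^ m * Real.sqrt (m.factorial) * m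
      = (m : ℝ) ^ m * (Real.sqrt (m.factorial) * m) := by ring
    _ ≤ (m : ℝ) ^ m * ((m.factorial : ℝ) * m) :=
        mul_le_mul_of_nonneg_left (mul_le_mul_of_nonneg_right hsqrt (Nat.cast_nonneg m)) hmm
    _ ≤ (m : ℝ) ^ m * (3 * Real.log 2 ^ m * (m : ℝ) ^ m) :=
        mul_le_mul_of_nonneg_left (factorial_mul_le m) hmm
    _ = 3 * Real.log 2 ^ m * (m : ℝ) ^ (2 * m) := by rw [two_mul, pow_add]; ring

/-! ### The reduction theorem, sharp form (WP-M♭) -/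

/-- **Reduction to signed principal-unit generators, sharp form (WP-M♭).** Let `p` be an odd prime,
`q₁, …, q_m` distinct primes `≠ p` and `e ∈ ℤ^m ∖ {0}` with `ord_p(∏ qᵢ^{eᵢ} − 1) ≥ 1`. Then there
are rationals `α₁, …, α_m` and `e' ∈ ℤ^m ∖ {0}` with: `ord_p(αⱼ − 1) ≥ 1`; the `αⱼ` multiplicatively
independent; no non-empty sub-product of the `αⱼ` a square in `ℚ`; `∏ qᵢ^{eᵢ} = ∏ αⱼ^{e'ⱼ}`;
`∏ h(αⱼ) ≤ m^m · √(m!) · p · ∏ log qᵢ`; `|e'ⱼ| ≤ m^{2m} · p · (∏ log qᵢ) · max|eᵢ|`; and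
`log p ≤ 2 h(αⱼ)`. Construction as in `exists_principal_generators` (WP-M): `αⱼ = α̃(bⱼ)` for a
`ℤ`-basis `b` of the signed principal-unit lattice `Λ^±` (index `d ≤ p − 1`), now chosen by
`exists_basis_prod_weighted_le_sharp` with `∏ⱼ F(bⱼ) ≤ m^m √(m!) · d · ∏ log qᵢ`; coordinates by
Cramer (`card_mul_abs_repr_mul_prod_le`), numerics by `pow_mul_sqrt_factorial_mul_le`. [folklore] -/
theorem exists_principal_generators_sharp :
    ∀ (p : ℕ), p.Prime → p ≠ 2 → ∀ (m : ℕ) (q : Fin m → ℕ),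
    (∀ i, (q i).Prime) → Function.Injective q → (∀ i, q i ≠ p) →
    ∀ (e : Fin m → ℤ), e ≠ 0 → 1 ≤ padicValRat p (∏ i, (q i : ℚ) ^ e i - 1) →
    ∃ (α : Fin m → ℚ) (e' : Fin m → ℤ),
      (∀ j, α j ≠ 0 ∧ 1 ≤ padicValRat p (α j - 1)) ∧
      (∀ μ : Fin m → ℤ, ∏ j, α j ^ μ j = 1 → μ = 0) ∧
      (∀ T : Finset (Fin m), T.Nonempty → ¬ IsSquare (∏ j ∈ T, α j)) ∧
      e' ≠ 0 ∧ ∏ i, (q i : ℚ) ^ e i = ∏ j, α j ^ e' j ∧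
      (∏ j, logHeight₁ (α j)) ≤ (m : ℝ) ^ m * Real.sqrt (m.factorial) * p * ∏ i, Real.log (q i) ∧
      (∀ j, (|e' j| : ℝ) ≤
        (m : ℝ) ^ (2 * m) * p * (∏ i, Real.log (q i)) * (Finset.univ.sup fun i => (e i).natAbs)) ∧
      (∀ j, Real.log p ≤ 2 * logHeight₁ (α j)) := by
  intro p hp hp2 m q hq hinj hqp e he hval
  classical
  haveI := Fact.mk hp
  -- `m = 0` is impossible
  rcases Nat.eq_zero_or_pos m with hm | hm
  · subst hm; exact absurd (funext fun i => Fin.elim0 i) he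
  have hq0 : ∀ i, ((q i : ℕ) : ZMod p) ≠ 0 := fun i h =>
    hqp i (((Nat.prime_dvd_prime_iff_eq hp (hq i)).mp ((ZMod.natCast_eq_zero_iff _ _).mp h)).symm)
  -- weights `wᵢ = log qᵢ`
  set w : Fin m → ℝ := fun i => Real.log (q i) with hw
  have hwpos : ∀ i, 0 < w i := fun i => Real.log_pos (by exact_mod_cast (hq i).one_lt)
  have hwge : ∀ i, Real.log 2 ≤ w i := fun i =>
    Real.log_le_log two_pos (by exact_mod_cast (hq i).two_le)
  have hΩ : 0 < ∏ i, w i := Finset.prod_pos fun i _ => hwpos i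
  have hL : (0.6931471803 : ℝ) < Real.log 2 := Real.log_two_gt_d9
  have hL0 : 0 < Real.log 2 := by linarith
  -- the lattice `Λ^±` and its index `d ≤ p − 1`
  set L := latPMSub q hq0 with hLdef
  have hidx := index_latPM_le q hq0
  have hcardL : Nat.card ((Fin m → ℤ) ⧸ L) = (latPM q hq0).index := rfl
  haveI : Finite ((Fin m → ℤ) ⧸ L) :=
    Nat.finite_of_card_ne_zero (by rw [hcardL]; exact hidx.2.ne')
  set d : ℕ := Nat.card ((Fin m → ℤ) ⧸ L) with hd
  have hd0 : 0 < d := by rw [hcardL]; exact hidx.2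
  have hdp : (d : ℝ) ≤ p := by
    have h1 : d ≤ p - 1 := by rw [hcardL]; exact hidx.1
    have h2 : p - 1 ≤ p := Nat.sub_le p 1
    exact_mod_cast h1.trans h2
  -- the good basis and the generators
  obtain ⟨b, hb⟩ := exists_basis_prod_weighted_le_sharp hm L w hwpos
  have heker := expHom_eq_zero_of_one_le_padicValRat q hq hqp hq0 hval
  have heΛ : e ∈ latPM q hq0 := mem_latPM_of_one_le_padicValRat q hq hqp hq0 hval
  set eL : L := ⟨e, heΛ⟩ with heL
  set α : Fin m → ℚ := fun j => signedProd q hq0 (b j : Fin m → ℤ) with hα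
  set e' : Fin m → ℤ := fun j => b.equivFun eL j with he'
  have hbne : ∀ j, ((b j : L) : Fin m → ℤ) ≠ 0 := fun j h =>
    b.ne_zero j (Subtype.ext h)
  have hα1 : ∀ j, 1 ≤ padicValRat p (α j - 1) := fun j =>
    one_le_padicValRat_signedProd_sub_one q hq hinj hqp hq0 (b j).2 (hbne j)
  -- the weighted norms `F(b_j) ≥ log 2` and `F(e) ≤ B ∑ wᵢ`
  set Fb : Fin m → ℝ := fun j => ∑ i, w i * |(((b j : L) : Fin m → ℤ) i : ℝ)| with hFb
  have hFb_ge : ∀ j, Real.log 2 ≤ Fb j := by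
    intro j
    obtain ⟨i, hi⟩ : ∃ i, ((b j : L) : Fin m → ℤ) i ≠ 0 := by
      by_contra h; push Not at h; exact hbne j (funext h)
    have h1 : (1 : ℝ) ≤ |(((b j : L) : Fin m → ℤ) i : ℝ)| := by
      rw [← Int.cast_abs]; exact_mod_cast Int.one_le_abs hi
    calc Real.log 2 ≤ w i * |(((b j : L) : Fin m → ℤ) i : ℝ)| := by
          nlinarith [hwge i, hwpos i]
      _ ≤ Fb j := Finset.single_le_sum (f := fun i => w i * |(((b j : L) : Fin m → ℤ) i : ℝ)|)
          (fun k _ => mul_nonneg (hwpos k).le (abs_nonneg _)) (Finset.mem_univ i)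
  have hFb_pos : ∀ j, 0 < Fb j := fun j => hL0.trans_le (hFb_ge j)
  set Bmax : ℝ := ((Finset.univ.sup fun i => (e i).natAbs : ℕ) : ℝ) with hBmax
  have hBmax0 : 0 ≤ Bmax := Nat.cast_nonneg _
  have heB : ∀ i, |(e i : ℝ)| ≤ Bmax := by
    intro i
    rw [← Int.cast_abs, show ((|e i| : ℤ) : ℝ) = ((e i).natAbs : ℝ) by
      rw [Nat.cast_natAbs], hBmax]
    exact_mod_cast Finset.le_sup (f := fun i => (e i).natAbs) (Finset.mem_univ i)
  have hFe : ∑ i, w i * |(e i : ℝ)| ≤ Bmax * ∑ i, w i := by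
    rw [Finset.mul_sum]
    exact Finset.sum_le_sum fun i _ => by
      rw [mul_comm Bmax]; exact mul_le_mul_of_nonneg_left (heB i) (hwpos i).le
  -- `(log 2)^{m-1} ∑ wᵢ ≤ m ∏ wᵢ`
  have hsumw : Real.log 2 ^ (m - 1) * ∑ i, w i ≤ m * ∏ i, w i := by
    rw [Finset.mul_sum]
    have h1 : ∀ i, Real.log 2 ^ (m - 1) * w i ≤ ∏ k, w k := by
      intro i
      rw [← Finset.mul_prod_erase Finset.univ w (Finset.mem_univ i), mul_comm]
      refine mul_le_mul_of_nonneg_left ?_ (hwpos i).le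
      have hcard : (Finset.univ.erase i).card = m - 1 := by
        rw [Finset.card_erase_of_mem (Finset.mem_univ i), Finset.card_univ, Fintype.card_fin]
      calc Real.log 2 ^ (m - 1) = ∏ _k ∈ Finset.univ.erase i, Real.log 2 := by
            rw [Finset.prod_const, hcard]
        _ ≤ ∏ k ∈ Finset.univ.erase i, w k :=
            Finset.prod_le_prod (fun k _ => hL0.le) fun k _ => hwge k
    calc ∑ i, Real.log 2 ^ (m - 1) * w i ≤ ∑ _i : Fin m, ∏ k, w k :=
          Finset.sum_le_sum fun i _ => h1 i
      _ = m * ∏ i, w i := by rw [Finset.sum_const, Finset.card_univ, Fintype.card_fin]; ring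
  -- numerical constants
  have hfact := pow_mul_sqrt_factorial_mul_le m
  have hp3 : (3 : ℝ) ≤ p := by
    have := hp.two_le
    have h3 : 3 ≤ p := by omega
    exact_mod_cast h3
  refine ⟨α, e', fun j => ⟨?_, hα1 j⟩, ?_, ?_, ?_, ?_, ?_, ?_, fun j => ?_⟩
  · -- `αⱼ ≠ 0`
    rw [hα]
    simp only
    unfold signedProd
    refine mul_ne_zero ?_ (prod_zpow_pos q hq _).ne'
    rcases unitSign_eq_or q hq0 ((b j : L) : Fin m → ℤ) with h | h <;> rw [h] <;> norm_num
  · -- multiplicative independence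
    exact fun μ hμ => signedProd_basis_independent q hq0 b hq hinj μ hμ
  · -- Kummer condition
    exact fun T hT => not_isSquare_prod_signedProd_basis q hq0 b hq hinj T hT
  · -- `e' ≠ 0`
    intro h0
    apply he
    have h1 : b.equivFun eL = 0 := funext fun j => congrFun h0 j
    have h2 : eL = 0 := (LinearEquiv.map_eq_zero_iff _).mp h1
    exact congrArg Subtype.val h2
  · -- the identity
    exact prod_signedProd_zpow_repr q hq0 b hq hp2 heker heΛ
  · -- heights product
    calc ∏ j, logHeight₁ (α j) ≤ ∏ j, Fb j :=
          Finset.prod_le_prod (fun j _ => Height.zero_le_logHeight₁ _)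
            fun j _ => logHeight₁_signedProd_le q hq hq0 _
      _ ≤ (m : ℝ) ^ m * Real.sqrt (m.factorial) * d * ∏ i, w i := hb
      _ ≤ (m : ℝ) ^ m * Real.sqrt (m.factorial) * p * ∏ i, w i := by gcongr
  · -- the exponents `e'`
    intro j
    have hcr := card_mul_abs_repr_mul_prod_le hm L b w hwpos eL j
    rw [← hd] at hcr
    have he'j : (b.repr eL j : ℝ) = (e' j : ℝ) := by
      rw [he']; simp only [Module.Basis.equivFun_apply]
    rw [he'j] at hcr
    -- `d |e'ⱼ| Ω Fb j ≤ F(e) ∏ Fb ≤ F(e) (m!)² d Ω`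
    have h1 : (d : ℝ) * |(e' j : ℝ)| * (∏ i, w i) * Fb j ≤
        (∑ i, w i * |(e i : ℝ)|) * (((m : ℝ) ^ m * Real.sqrt (m.factorial)) * d * ∏ i, w i) := by
      have h2 := mul_le_mul_of_nonneg_right hcr (hFb_pos j).le
      have h3 : (∏ k ∈ Finset.univ.erase j, Fb k) * Fb j = ∏ k, Fb k := by
        rw [mul_comm, Finset.mul_prod_erase _ _ (Finset.mem_univ j)]
      calc (d : ℝ) * |(e' j : ℝ)| * (∏ i, w i) * Fb j
          ≤ (∑ i, w i * |(e i : ℝ)|) * (∏ k ∈ Finset.univ.erase j, Fb k) * Fb j := h2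
        _ = (∑ i, w i * |(e i : ℝ)|) * ∏ k, Fb k := by rw [mul_assoc, h3]
        _ ≤ (∑ i, w i * |(e i : ℝ)|) * (((m : ℝ) ^ m * Real.sqrt (m.factorial)) * d * ∏ i, w i) :=
            mul_le_mul_of_nonneg_left hb
              (Finset.sum_nonneg fun i _ => mul_nonneg (hwpos i).le (abs_nonneg _))
    -- cancel `d Ω > 0`: `|e'ⱼ| Fb j ≤ (m!)² F(e)`
    have h4 : |(e' j : ℝ)| * Fb j ≤ ((m : ℝ) ^ m * Real.sqrt (m.factorial)) * ∑ i, w i * |(e i : ℝ)| := by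
      have hdΩ : (0 : ℝ) < d * ∏ i, w i := mul_pos (by exact_mod_cast hd0) hΩ
      have : (d * ∏ i, w i) * (|(e' j : ℝ)| * Fb j) ≤
          (d * ∏ i, w i) * (((m : ℝ) ^ m * Real.sqrt (m.factorial)) * ∑ i, w i * |(e i : ℝ)|) := by
        calc (d * ∏ i, w i) * (|(e' j : ℝ)| * Fb j)
            = (d : ℝ) * |(e' j : ℝ)| * (∏ i, w i) * Fb j := by ring
          _ ≤ (∑ i, w i * |(e i : ℝ)|) * (((m : ℝ) ^ m * Real.sqrt (m.factorial)) * d * ∏ i, w i) := h1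
          _ = (d * ∏ i, w i) * (((m : ℝ) ^ m * Real.sqrt (m.factorial)) * ∑ i, w i * |(e i : ℝ)|) := by ring
      exact le_of_mul_le_mul_left this hdΩ
    -- `|e'ⱼ| (log 2)^m ≤ (m!)² Bmax (log 2)^{m-1} ∑ w ≤ (m!)² m Bmax Ω ≤ 3 (log 2)^m m^{2m} Bmax Ω`
    have h5 : |(e' j : ℝ)| * Real.log 2 ^ m ≤
        3 * Real.log 2 ^ m * (m : ℝ) ^ (2 * m) * Bmax * ∏ i, w i := by
      have hm1 : Real.log 2 ^ m = Real.log 2 ^ (m - 1) * Real.log 2 :=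
        (pow_sub_one_mul hm.ne' _).symm
      calc |(e' j : ℝ)| * Real.log 2 ^ m
          = (|(e' j : ℝ)| * Real.log 2) * Real.log 2 ^ (m - 1) := by rw [hm1]; ring
        _ ≤ (|(e' j : ℝ)| * Fb j) * Real.log 2 ^ (m - 1) :=
            mul_le_mul_of_nonneg_right (mul_le_mul_of_nonneg_left (hFb_ge j) (abs_nonneg _))
              (by positivity)
        _ ≤ (((m : ℝ) ^ m * Real.sqrt (m.factorial)) * (Bmax * ∑ i, w i)) * Real.log 2 ^ (m - 1) :=
            mul_le_mul_of_nonneg_right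
              (h4.trans (mul_le_mul_of_nonneg_left hFe (by positivity))) (by positivity)
        _ = ((m : ℝ) ^ m * Real.sqrt (m.factorial)) * Bmax * (Real.log 2 ^ (m - 1) * ∑ i, w i) := by ring
        _ ≤ ((m : ℝ) ^ m * Real.sqrt (m.factorial)) * Bmax * (m * ∏ i, w i) :=
            mul_le_mul_of_nonneg_left hsumw (by positivity)
        _ = (((m : ℝ) ^ m * Real.sqrt (m.factorial)) * m) * Bmax * ∏ i, w i := by ring
        _ ≤ (3 * Real.log 2 ^ m * (m : ℝ) ^ (2 * m)) * Bmax * ∏ i, w i := by gcongr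
        _ = 3 * Real.log 2 ^ m * (m : ℝ) ^ (2 * m) * Bmax * ∏ i, w i := by ring
    have h6 : |(e' j : ℝ)| ≤ 3 * (m : ℝ) ^ (2 * m) * Bmax * ∏ i, w i := by
      have hLm : (0 : ℝ) < Real.log 2 ^ m := by positivity
      have : Real.log 2 ^ m * |(e' j : ℝ)| ≤
          Real.log 2 ^ m * (3 * (m : ℝ) ^ (2 * m) * Bmax * ∏ i, w i) := by
        calc Real.log 2 ^ m * |(e' j : ℝ)| = |(e' j : ℝ)| * Real.log 2 ^ m := mul_comm _ _
          _ ≤ _ := h5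
          _ = Real.log 2 ^ m * (3 * (m : ℝ) ^ (2 * m) * Bmax * ∏ i, w i) := by ring
      exact le_of_mul_le_mul_left this hLm
    calc |(e' j : ℝ)| ≤ 3 * (m : ℝ) ^ (2 * m) * Bmax * ∏ i, w i := h6
      _ ≤ (p : ℝ) * (m : ℝ) ^ (2 * m) * Bmax * ∏ i, w i := by gcongr
      _ = (m : ℝ) ^ (2 * m) * p * (∏ i, w i) * Bmax := by ring
  · -- the floor
    exact log_le_two_mul_logHeight₁ hp2 (hα1 j)

end Summit.ABC.StewartYu.PrincipalLattice

end
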